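/-
Copyright (c) 2026. All rights reserved.
Released under Apache 2.0 license as described in the file LICENSE.
Authors: abc-iut cell, wave-3 discharge seat abc-iut-L6-d5.
-/
import Mathlib.RingTheory.Polynomial.Vieta
import Mathlib.RingTheory.Polynomial.Eisenstein.Basic
import Mathlib.RingTheory.Polynomial.Subring
import Mathlib.Analysis.Normed.Group.Ultra
import Mathlib.Analysis.Normed.Module.Basic
import Literature.NumberTheory.GaloisRepresentations.UniformizerResidueIndex
import HarnessLib

/-!
# Coefficients of a split polynomial from the absolute values of its roots; the Eisenstein
# criterion for the minimal polynomial of a uniformizer (norm form)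

Serre, *Local Fields* (GTM 67, 1979), Ch. I §6, Prop. 17–18 [SerreLocalFields1979]: over a complete
discretely valued field `K₀`, a root of an Eisenstein polynomial of degree `e` generates a totally
ramified extension of degree `e` of which it is a uniformizer, and conversely the minimal polynomial of
a uniformizer of a totally ramified extension of degree `e` is an Eisenstein polynomial of degree `e`.
Cassels, *Local Fields* (1986), Ch. 7 §3, Cor. 2 [Cassels1986]: all `K₀`-conjugates of an element of an
algebraic extension have the same absolute value (for the unique — spectral — extension of `‖·‖`).

This file proves the COEFFICIENT half of this dictionary in the NORM-side language of the tree
(`NormUniformizer.lean`, `UniformizerResidueIndex.lean`: `Valued.integer K₀ = {‖x‖ ≤ 1}` for the scoped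
instance `NormedField.toValued`, `𝔪 = {‖x‖ < 1}`), over an arbitrary normed field extension `L` of a
normed field `K₀` in which the polynomial splits, with the conjugate-invariance of `‖·‖` as an explicit
hypothesis on the roots (it holds for the spectral norm, where `‖β‖ = spectralValue (minpoly K₀ β)`):

* `norm_multiset_sum_le_of_forall_le`, `norm_multiset_prod_le_pow`, `norm_multiset_prod_eq_pow`,
  `norm_esymm_le_pow` — ultrametric bookkeeping: if every element of a multiset `s` has norm `≤ r` then
  `‖e_k(s)‖ ≤ r^k` for the elementary symmetric functions;
* `norm_coeff_le_of_roots_norm_le` — for `f ∈ K₀[X]` monic splitting in `L` with all roots of norm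
  `≤ r`: `‖a_k‖ ≤ r^{n−k}` (`n = deg f`); `norm_coeff_zero_eq_of_roots_norm_eq` — if all roots have
  norm `= r` then `‖a_0‖ = r^n`;
* `coeffs_subset_integer_of_roots_norm_le_one` — roots of norm `≤ 1` ⇒ `f ∈ 𝒪_{K₀}[X]`;
* `norm_le_mul_of_mem_maximalIdeal_sq` — `x ∈ 𝔪² ⇒ ‖x‖ ≤ ‖ϖ‖²` for a norm uniformizer `ϖ`;
* **`isEisensteinAt_toSubring_of_roots_norm`** — if all roots of the monic `f` (degree `n ≥ 1`) in `L`
  have the same norm `r` with `r < 1` and `r^n = ‖ϖ‖` (`ϖ` a norm uniformizer of `K₀`: the root is a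
  uniformizer of a totally ramified extension of degree `n`), then `f`, as a polynomial over
  `𝒪_{K₀}`, is Eisenstein at `𝔪` (Serre I §6 Prop. 18, "⇒" direction);
* `roots_norm_pow_eq_of_coeff` — conversely `r^n = ‖a_0‖` for the common norm `r` of the roots
  (Prop. 17: a root of an Eisenstein polynomial, `‖a_0‖ = ‖ϖ‖`, satisfies `‖π‖^n = ‖ϖ‖`).

Purpose (abc-iut cell, campaign S): the structure input "every finite extension of `ℚ_p` inside `ℚ̄_p`
is generated over its maximal unramified subextension by a root of an Eisenstein polynomial" of the
finiteness of the set of subextensions of `ℚ̄_p/ℚ_p` of bounded degree (Lang, *Algebraic Number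
Theory*, II §5 Prop. 14; abc-iut-S4's named fact `krasner_finite_subextensions`). Classical and
undisputed; no named facts here — everything is proved.
-/

set_option autoImplicit false

noncomputable section

open Polynomial Multiset IsLocalRing
open scoped NormedField

namespace Literature.NumberTheory.GaloisRepresentations

/-! ## Ultrametric bookkeeping for multiset sums, products and elementary symmetric functions -/

section UltrametricSums

variable {M : Type*} [SeminormedAddCommGroup M] [IsUltrametricDist M]

/-- In an ultrametric group, a multiset sum of elements of norm `≤ C` (`C ≥ 0`) has norm `≤ C`.
[cite: Cassels1986, Ch. 2 §1] -/
theorem norm_multiset_sum_le_of_forall_le {s : Multiset M} {C : ℝ} (hC : 0 ≤ C)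
    (h : ∀ x ∈ s, ‖x‖ ≤ C) : ‖s.sum‖ ≤ C := by
  induction s using Multiset.induction_on with
  | empty => simpa using hC
  | cons a s ih =>
    rw [Multiset.sum_cons]
    exact (IsUltrametricDist.norm_add_le_max _ _).trans
      (max_le (h a (Multiset.mem_cons_self a s)) (ih fun x hx => h x (Multiset.mem_cons_of_mem hx)))

end UltrametricSums

section Esymm

variable {L : Type*} [NormedField L]

/-- A multiset product of elements of norm `≤ r` (`r ≥ 0`) has norm `≤ r ^ card`.
[cite: Cassels1986, Ch. 2 §1] -/
theorem norm_multiset_prod_le_pow {s : Multiset L} {r : ℝ} (hr : 0 ≤ r) (h : ∀ x ∈ s, ‖x‖ ≤ r) :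
    ‖s.prod‖ ≤ r ^ Multiset.card s := by
  induction s using Multiset.induction_on with
  | empty => simp
  | cons a s ih =>
    rw [Multiset.prod_cons, norm_mul, Multiset.card_cons, pow_succ']
    exact mul_le_mul (h a (Multiset.mem_cons_self a s))
      (ih fun x hx => h x (Multiset.mem_cons_of_mem hx)) (norm_nonneg _) hr

/-- A multiset product of elements of norm `= r` has norm `r ^ card`. [cite: Cassels1986, Ch. 2 §1] -/
theorem norm_multiset_prod_eq_pow {s : Multiset L} {r : ℝ} (h : ∀ x ∈ s, ‖x‖ = r) :
    ‖s.prod‖ = r ^ Multiset.card s := by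
  induction s using Multiset.induction_on with
  | empty => simp
  | cons a s ih =>
    rw [Multiset.prod_cons, norm_mul, Multiset.card_cons, pow_succ', h a (Multiset.mem_cons_self a s),
      ih fun x hx => h x (Multiset.mem_cons_of_mem hx)]

variable [IsUltrametricDist L]

/-- **Elementary symmetric functions of small elements are small** (ultrametric): if every element of
`s` has norm `≤ r` then `‖e_k(s)‖ ≤ r ^ k`. [cite: Cassels1986, Ch. 7 §3 Cor. 2] -/
theorem norm_esymm_le_pow {s : Multiset L} {r : ℝ} (hr : 0 ≤ r) (h : ∀ x ∈ s, ‖x‖ ≤ r) (k : ℕ) :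
    ‖s.esymm k‖ ≤ r ^ k := by
  unfold Multiset.esymm
  refine norm_multiset_sum_le_of_forall_le (pow_nonneg hr k) fun y hy => ?_
  obtain ⟨t, ht, rfl⟩ := Multiset.mem_map.mp hy
  obtain ⟨hts, hcard⟩ := Multiset.mem_powersetCard.mp ht
  rw [← hcard]
  exact norm_multiset_prod_le_pow hr fun x hx => h x (Multiset.mem_of_le hts hx)

end Esymm

/-! ## Coefficients of a split monic polynomial from the norms of its roots -/

section Coeff

variable {K₀ L : Type*} [NormedField K₀] [NormedField L] [NormedAlgebra K₀ L]

/-- The map of a monic polynomial to an extension has the same degree (plumbing).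
[cite: SerreLocalFields1979, Ch. I §6 Prop. 18] -/
theorem natDegree_map_algebraMap_of_monic {f : K₀[X]} (hf : f.Monic) :
    (f.map (algebraMap K₀ L)).natDegree = f.natDegree :=
  hf.natDegree_map _

variable [IsUltrametricDist L]

/-- **Coefficient bounds from root bounds**: if the monic `f ∈ K₀[X]` splits in the ultrametric
extension `L` and all its roots there have norm `≤ r`, then `‖a_k‖ ≤ r^{n−k}`, `n = deg f`
(the coefficient `a_k` is `± e_{n−k}` of the roots). [cite: Cassels1986, Ch. 7 §3 Cor. 2] -/
theorem norm_coeff_le_of_roots_norm_le {f : K₀[X]} (hf : f.Monic)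
    (hsplit : (f.map (algebraMap K₀ L)).Splits) {r : ℝ} (hr : 0 ≤ r)
    (hroots : ∀ β ∈ (f.map (algebraMap K₀ L)).roots, ‖β‖ ≤ r) {k : ℕ} (hk : k ≤ f.natDegree) :
    ‖f.coeff k‖ ≤ r ^ (f.natDegree - k) := by
  have hgm : (f.map (algebraMap K₀ L)).Monic := hf.map _
  have hdeg := natDegree_map_algebraMap_of_monic (L := L) hf
  have hvieta := Polynomial.coeff_eq_esymm_roots_of_splits hsplit (k := k) (hdeg.symm ▸ hk)
  rw [hgm.leadingCoeff, one_mul, Polynomial.coeff_map] at hvieta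
  calc ‖f.coeff k‖ = ‖algebraMap K₀ L (f.coeff k)‖ := (norm_algebraMap' L (f.coeff k)).symm
    _ = ‖(f.map (algebraMap K₀ L)).roots.esymm ((f.map (algebraMap K₀ L)).natDegree - k)‖ := by
        rw [hvieta, norm_mul, norm_pow, norm_neg, norm_one, one_pow, one_mul]
    _ ≤ r ^ ((f.map (algebraMap K₀ L)).natDegree - k) := norm_esymm_le_pow hr hroots _
    _ = r ^ (f.natDegree - k) := by rw [hdeg]

omit [IsUltrametricDist L] in
/-- **The constant coefficient**: if all roots of the monic split `f` have norm exactly `r`, then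
`‖a_0‖ = r^n` (`a_0 = ± ∏ roots`). [cite: Cassels1986, Ch. 7 §3 Cor. 2] -/
theorem norm_coeff_zero_eq_of_roots_norm_eq {f : K₀[X]} (hf : f.Monic)
    (hsplit : (f.map (algebraMap K₀ L)).Splits) {r : ℝ}
    (hroots : ∀ β ∈ (f.map (algebraMap K₀ L)).roots, ‖β‖ = r) :
    ‖f.coeff 0‖ = r ^ f.natDegree := by
  have hgm : (f.map (algebraMap K₀ L)).Monic := hf.map _
  have hdeg := natDegree_map_algebraMap_of_monic (L := L) hf
  have h0 := hsplit.coeff_zero_eq_prod_roots_of_monic hgm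
  rw [Polynomial.coeff_map] at h0
  calc ‖f.coeff 0‖ = ‖algebraMap K₀ L (f.coeff 0)‖ := (norm_algebraMap' L (f.coeff 0)).symm
    _ = ‖(f.map (algebraMap K₀ L)).roots.prod‖ := by
        rw [h0, norm_mul, norm_pow, norm_neg, norm_one, one_pow, one_mul]
    _ = r ^ Multiset.card (f.map (algebraMap K₀ L)).roots := norm_multiset_prod_eq_pow hroots
    _ = r ^ f.natDegree := by rw [← hsplit.natDegree_eq_card_roots, hdeg]

omit [IsUltrametricDist L] in
/-- **The common root norm from the constant coefficient** (Serre I §6 Prop. 17, norm form): if all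
roots of the monic split `f` of degree `n` have norm `r`, then `r^n = ‖a_0‖`; in particular a root of
an Eisenstein polynomial (`‖a_0‖ = ‖ϖ‖`) satisfies `‖π‖^n = ‖ϖ‖`. [cite: SerreLocalFields1979, Ch. I §6 Prop. 17] -/
theorem roots_norm_pow_eq_of_coeff {f : K₀[X]} (hf : f.Monic)
    (hsplit : (f.map (algebraMap K₀ L)).Splits) {r : ℝ}
    (hroots : ∀ β ∈ (f.map (algebraMap K₀ L)).roots, ‖β‖ = r) :
    r ^ f.natDegree = ‖f.coeff 0‖ :=
  (norm_coeff_zero_eq_of_roots_norm_eq hf hsplit hroots).symm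

/-- Roots of norm `≤ 1` ⇒ every coefficient of the monic `f` has norm `≤ 1`.
[cite: SerreLocalFields1979, Ch. I §6 Prop. 18] -/
theorem norm_coeff_le_one_of_roots_norm_le_one {f : K₀[X]} (hf : f.Monic)
    (hsplit : (f.map (algebraMap K₀ L)).Splits)
    (hroots : ∀ β ∈ (f.map (algebraMap K₀ L)).roots, ‖β‖ ≤ 1) (k : ℕ) : ‖f.coeff k‖ ≤ 1 := by
  rcases le_or_gt k f.natDegree with hk | hk
  · simpa using norm_coeff_le_of_roots_norm_le hf hsplit zero_le_one hroots hk
  · rw [Polynomial.coeff_eq_zero_of_natDegree_lt hk, norm_zero]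
    exact zero_le_one

end Coeff

/-! ## The Eisenstein criterion for the minimal polynomial of a uniformizer (norm form) -/

section Eisenstein

open Literature.NumberTheory.GaloisRepresentations.Ultrametric

variable {K₀ L : Type*} [NontriviallyNormedField K₀] [IsUltrametricDist K₀] [NormedField L]
  [NormedAlgebra K₀ L] [IsUltrametricDist L]

/-- Roots of norm `≤ 1` ⇒ the monic `f` has all its coefficients in `𝒪_{K₀} = {‖x‖ ≤ 1}` (so that
`f.toSubring 𝒪_{K₀}` makes sense). [cite: SerreLocalFields1979, Ch. I §6 Prop. 18] -/
theorem coeffs_subset_integer_of_roots_norm_le_one {f : K₀[X]} (hf : f.Monic)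
    (hsplit : (f.map (algebraMap K₀ L)).Splits)
    (hroots : ∀ β ∈ (f.map (algebraMap K₀ L)).roots, ‖β‖ ≤ 1) :
    (↑f.coeffs : Set K₀) ⊆ (Valued.integer K₀ : Subring K₀) := by
  intro c hc
  obtain ⟨n, -, rfl⟩ := Polynomial.mem_coeffs_iff.mp (Finset.mem_coe.mp hc)
  exact Valued.integer.mem_iff.mpr (norm_coeff_le_one_of_roots_norm_le_one hf hsplit hroots n)

/-- `x ∈ 𝔪 · 𝔪` in `𝒪_{K₀}` ⇒ `‖x‖ ≤ ‖ϖ‖²` for a norm uniformizer `ϖ` (every element of `𝔪` has norm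
`< 1`, hence `≤ ‖ϖ‖`; products and, ultrametrically, sums keep the bound).
[cite: SerreLocalFields1979, Ch. I §6 Prop. 18] -/
theorem norm_le_mul_of_mem_maximalIdeal_sq {ϖ : K₀ˣ} (hϖ : IsUniformizer ϖ)
    {x : Valued.integer K₀} (hx : x ∈ (maximalIdeal (Valued.integer K₀)) ^ 2) :
    ‖(x : K₀)‖ ≤ ‖(ϖ : K₀)‖ * ‖(ϖ : K₀)‖ := by
  rw [pow_two] at hx
  refine Submodule.mul_induction_on hx (fun a ha b hb => ?_) (fun a b ha hb => ?_)
  · have ha' : ‖(a : K₀)‖ ≤ ‖(ϖ : K₀)‖ :=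
      hϖ.norm_le_of_norm_lt_one _ ((mem_maximalIdeal_iff_norm_lt_one a).mp ha)
    have hb' : ‖(b : K₀)‖ ≤ ‖(ϖ : K₀)‖ :=
      hϖ.norm_le_of_norm_lt_one _ ((mem_maximalIdeal_iff_norm_lt_one b).mp hb)
    change ‖(a : K₀) * (b : K₀)‖ ≤ _
    rw [norm_mul]
    exact mul_le_mul ha' hb' (norm_nonneg _) (norm_nonneg _)
  · change ‖(a : K₀) + (b : K₀)‖ ≤ _
    exact (IsUltrametricDist.norm_add_le_max _ _).trans (max_le ha hb)

/-- **Serre, Local Fields I §6 Prop. 18 (norm form): the minimal polynomial of a uniformizer of a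
totally ramified extension is Eisenstein.** Let `f ∈ K₀[X]` be monic of degree `n` (necessarily
`n ≥ 1`, `natDegree_pos_of_pow_eq_norm_uniformizer`), split in the
ultrametric extension `L`, with all roots of the same norm `r` (conjugate-invariance of `‖·‖`), and
suppose `r < 1` and `r^n = ‖ϖ‖` for a norm uniformizer `ϖ` of `K₀`. Then `f`, viewed in `𝒪_{K₀}[X]`, is
an Eisenstein polynomial at `𝔪`: `a_k ∈ 𝔪` for `k < n` (`‖a_k‖ ≤ r^{n−k} < 1`), `a_n = 1 ∉ 𝔪`, and
`a_0 ∉ 𝔪²` (`‖a_0‖ = ‖ϖ‖ > ‖ϖ‖²`). [cite: SerreLocalFields1979, Ch. I §6 Prop. 18] -/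
theorem isEisensteinAt_toSubring_of_roots_norm {f : K₀[X]} (hf : f.Monic)
    (hsplit : (f.map (algebraMap K₀ L)).Splits) {r : ℝ} (hr : 0 ≤ r) (hr1 : r < 1)
    (hroots : ∀ β ∈ (f.map (algebraMap K₀ L)).roots, ‖β‖ = r) {ϖ : K₀ˣ} (hϖ : IsUniformizer ϖ)
    (hrn : r ^ f.natDegree = ‖(ϖ : K₀)‖)
    (hcoeffs : (↑f.coeffs : Set K₀) ⊆ (Valued.integer K₀ : Subring K₀)) :
    (f.toSubring (Valued.integer K₀) hcoeffs).IsEisensteinAt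
      (maximalIdeal (Valued.integer K₀)) := by
  have hroots' : ∀ β ∈ (f.map (algebraMap K₀ L)).roots, ‖β‖ ≤ r := fun β hβ => (hroots β hβ).le
  refine ⟨?_, ?_, ?_⟩
  · -- leading coefficient `1 ∉ 𝔪`
    have hmonic : (f.toSubring (Valued.integer K₀) hcoeffs).Monic :=
      (Polynomial.monic_toSubring f _ hcoeffs).mpr hf
    rw [hmonic.leadingCoeff]
    exact (maximalIdeal.isMaximal (Valued.integer K₀)).ne_top ∘
      (Ideal.eq_top_of_isUnit_mem _ · isUnit_one)
  · -- `a_k ∈ 𝔪` for `k < n`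
    intro k hk
    rw [Polynomial.natDegree_toSubring] at hk
    rw [mem_maximalIdeal_iff_norm_lt_one]
    change ‖((f.toSubring (Valued.integer K₀) hcoeffs).coeff k : K₀)‖ < 1
    rw [Polynomial.coeff_toSubring]
    calc ‖f.coeff k‖ ≤ r ^ (f.natDegree - k) := norm_coeff_le_of_roots_norm_le hf hsplit hr hroots' hk.le
      _ < 1 := pow_lt_one₀ hr hr1 (Nat.sub_ne_zero_of_lt hk)
  · -- `a_0 ∉ 𝔪²`
    intro hmem
    have hle := norm_le_mul_of_mem_maximalIdeal_sq hϖ hmem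
    rw [Polynomial.coeff_toSubring, norm_coeff_zero_eq_of_roots_norm_eq hf hsplit hroots, hrn] at hle
    have hϖpos : 0 < ‖(ϖ : K₀)‖ := norm_pos_iff.mpr ϖ.ne_zero
    have : ‖(ϖ : K₀)‖ * ‖(ϖ : K₀)‖ < ‖(ϖ : K₀)‖ * 1 := mul_lt_mul_of_pos_left hϖ.norm_lt_one hϖpos
    rw [mul_one] at this
    exact absurd hle (not_le.mpr this)

omit [IsUltrametricDist K₀] in
/-- The degree bookkeeping of the same situation: `r^n = ‖ϖ‖` forces `n ≥ 1` (as `‖ϖ‖ ≠ 1`).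
[cite: SerreLocalFields1979, Ch. I §6 Prop. 18] -/
theorem natDegree_pos_of_pow_eq_norm_uniformizer {f : K₀[X]} {r : ℝ} {ϖ : K₀ˣ} (hϖ : IsUniformizer ϖ)
    (hrn : r ^ f.natDegree = ‖(ϖ : K₀)‖) : 0 < f.natDegree := by
  by_contra h
  rw [Nat.not_lt, Nat.le_zero] at h
  rw [h, pow_zero] at hrn
  exact absurd hrn.symm hϖ.norm_lt_one.ne

end Eisenstein

end Literature.NumberTheory.GaloisRepresentations


/-! ## Appendix (append-only): the degree of the minimal polynomial of a uniformizer (Serre I §6 Prop. 18)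

For `K₀ ⊆ K` with norm uniformizers `ϖ` of `K₀` and `π` of `K` related by `‖π‖^e = ‖ϖ‖` (`e ≥ 1`, the
ramification index in the norm sense), the minimal polynomial `f` of `π` over `K₀` — monic, all roots of
norm `‖π‖` — has degree DIVISIBLE by `e` (`‖a_0‖ = ‖π‖^{deg f}` lies in the value group `‖ϖ‖^ℤ` of
`K₀^×`); so if `1 ≤ deg f ≤ e` (e.g. `deg f ≤ [K : K₀] = e`, the totally ramified case) then `deg f = e`
— i.e. `K = K₀(π)` — and `f` is Eisenstein (`isEisensteinAt_toSubring_of_roots_norm`). -/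

namespace Literature.NumberTheory.GaloisRepresentations

section Degree

open Literature.NumberTheory.GaloisRepresentations.Ultrametric

/-- Real bookkeeping: if `r^e = t` and `r^d = t^k` with `0 < t ≠ 1`, then `d = e·k`.
[cite: SerreLocalFields1979, Ch. I §6 Prop. 18] -/
theorem natCast_eq_mul_of_pow_eq_of_pow_eq_zpow {r t : ℝ} (ht : 0 < t) (ht1 : t ≠ 1)
    {e d : ℕ} {k : ℤ} (he : r ^ e = t) (hd : r ^ d = t ^ k) : (d : ℝ) = e * k := by
  have h1 : (e : ℝ) * Real.log r = Real.log t := by rw [← Real.log_pow, he]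
  have h2 : (d : ℝ) * Real.log r = k * Real.log t := by rw [← Real.log_pow, hd, Real.log_zpow]
  have hlogt : Real.log t ≠ 0 := Real.log_ne_zero_of_pos_of_ne_one ht ht1
  have h3 : (d : ℝ) * Real.log t = (e * k : ℝ) * Real.log t := by
    calc (d : ℝ) * Real.log t = (d : ℝ) * ((e : ℝ) * Real.log r) := by rw [h1]
      _ = (e : ℝ) * ((d : ℝ) * Real.log r) := by ring
      _ = (e : ℝ) * (k * Real.log t) := by rw [h2]
      _ = (e * k : ℝ) * Real.log t := by ring
  exact mul_right_cancel₀ hlogt h3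

variable {K₀ L : Type*} [NontriviallyNormedField K₀] [NormedField L] [NormedAlgebra K₀ L]

/-- **Divisibility of the degree by the ramification index** (Serre I §6 Prop. 18, norm form): let
`f ∈ K₀[X]` be monic with `f(0) ≠ 0`, split in `L` with all roots of the same norm `r`, and suppose
`r^e = ‖ϖ‖` for a norm uniformizer `ϖ` of `K₀`; then `e ∣ deg f` (as `‖f(0)‖ = r^{deg f} ∈ ‖ϖ‖^ℤ`).
[cite: SerreLocalFields1979, Ch. I §6 Prop. 18] -/
theorem dvd_natDegree_of_roots_norm_pow_eq {f : K₀[X]} (hf : f.Monic)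
    (hsplit : (f.map (algebraMap K₀ L)).Splits) {r : ℝ}
    (hroots : ∀ β ∈ (f.map (algebraMap K₀ L)).roots, ‖β‖ = r) {ϖ : K₀ˣ} (hϖ : IsUniformizer ϖ)
    {e : ℕ} (hre : r ^ e = ‖(ϖ : K₀)‖) (h0 : f.coeff 0 ≠ 0) : e ∣ f.natDegree := by
  have hϖpos : 0 < ‖(ϖ : K₀)‖ := norm_pos_iff.mpr ϖ.ne_zero
  obtain ⟨k, hk⟩ := hϖ.2 (Units.mk0 (f.coeff 0) h0)
  rw [Units.val_mk0] at hk
  have hd : r ^ f.natDegree = ‖(ϖ : K₀)‖ ^ k := by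
    rw [roots_norm_pow_eq_of_coeff hf hsplit hroots, hk]
  have hcast := natCast_eq_mul_of_pow_eq_of_pow_eq_zpow hϖpos hϖ.norm_lt_one.ne hre hd
  have hint : (f.natDegree : ℤ) = e * k := by exact_mod_cast hcast
  exact Int.natCast_dvd_natCast.mp ⟨k, hint⟩

/-- If moreover `1 ≤ deg f ≤ e` then `deg f = e` (Serre I §6 Prop. 18: a uniformizer of a totally
ramified extension of degree `e` has minimal polynomial of degree exactly `e`, i.e. generates it).
[cite: SerreLocalFields1979, Ch. I §6 Prop. 18] -/
theorem natDegree_eq_of_roots_norm_pow_eq {f : K₀[X]} (hf : f.Monic)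
    (hsplit : (f.map (algebraMap K₀ L)).Splits) {r : ℝ}
    (hroots : ∀ β ∈ (f.map (algebraMap K₀ L)).roots, ‖β‖ = r) {ϖ : K₀ˣ} (hϖ : IsUniformizer ϖ)
    {e : ℕ} (hre : r ^ e = ‖(ϖ : K₀)‖) (h0 : f.coeff 0 ≠ 0) (hd : 0 < f.natDegree)
    (hle : f.natDegree ≤ e) : f.natDegree = e :=
  le_antisymm hle (Nat.le_of_dvd hd (dvd_natDegree_of_roots_norm_pow_eq hf hsplit hroots hϖ hre h0))

variable [IsUltrametricDist K₀] [IsUltrametricDist L]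

/-- **Serre, Local Fields I §6 Prop. 18, assembled (norm form).** Let `f ∈ K₀[X]` be monic of degree
`1 ≤ deg f ≤ e`, split in the ultrametric extension `L` with all roots of the same norm `r > 0`, and
`r^e = ‖ϖ‖` for a norm uniformizer `ϖ` of `K₀` (the roots are uniformizers of an extension of
ramification index `e` and degree `≤ e`). Then `deg f = e` and `f`, over `𝒪_{K₀}`, is Eisenstein at `𝔪`
(with the coefficient-integrality witness produced here). [cite: SerreLocalFields1979, Ch. I §6 Prop. 18] -/
theorem natDegree_eq_and_isEisensteinAt_of_roots_norm_pow_eq {f : K₀[X]} (hf : f.Monic)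
    (hsplit : (f.map (algebraMap K₀ L)).Splits) {r : ℝ} (hr : 0 < r)
    (hroots : ∀ β ∈ (f.map (algebraMap K₀ L)).roots, ‖β‖ = r) {ϖ : K₀ˣ} (hϖ : IsUniformizer ϖ)
    {e : ℕ} (hre : r ^ e = ‖(ϖ : K₀)‖) (hd : 0 < f.natDegree) (hle : f.natDegree ≤ e) :
    ∃ hcoeffs : (↑f.coeffs : Set K₀) ⊆ (Valued.integer K₀ : Subring K₀),
      f.natDegree = e ∧
        (f.toSubring (Valued.integer K₀) hcoeffs).IsEisensteinAt (maximalIdeal (Valued.integer K₀)) := by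
  -- `r < 1` since `r^e = ‖ϖ‖ < 1` (and `e ≥ 1` as `deg f ≥ 1`)
  have he : 0 < e := hd.trans_le hle
  have hr1 : r < 1 := by
    by_contra h
    have h1 : (1 : ℝ) ≤ r ^ e := one_le_pow₀ (not_lt.mp h)
    rw [hre] at h1
    exact absurd h1 (not_le.mpr hϖ.norm_lt_one)
  have hroots' : ∀ β ∈ (f.map (algebraMap K₀ L)).roots, ‖β‖ ≤ 1 :=
    fun β hβ => (hroots β hβ).le.trans hr1.le
  have hcoeffs := coeffs_subset_integer_of_roots_norm_le_one hf hsplit hroots'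
  -- `f(0) ≠ 0` since `‖f(0)‖ = r^{deg f} > 0`
  have h0 : f.coeff 0 ≠ 0 := by
    intro h
    have := norm_coeff_zero_eq_of_roots_norm_eq hf hsplit hroots
    rw [h, norm_zero] at this
    exact absurd this.symm (pow_pos hr _).ne'
  have hdeg : f.natDegree = e := natDegree_eq_of_roots_norm_pow_eq hf hsplit hroots hϖ hre h0 hd hle
  refine ⟨hcoeffs, hdeg, ?_⟩
  exact isEisensteinAt_toSubring_of_roots_norm hf hsplit hr.le hr1 hroots hϖ (hdeg ▸ hre) hcoeffs

end Degree

end Literature.NumberTheory.GaloisRepresentations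

end
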